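import Summits.BirchSwinnertonDyer.BirchSwinnertonDyer.Theses.CumulativeHeegnerLeopoldt
import Summits.BirchSwinnertonDyer.Rank1Residual.X11b.AnticyclotomicModuleFinite
import HarnessLib

/-!
# Route `CumulativeHeegnerLeopoldt`, crux K1 `CumulativeHeegnerInclusionAtThree` (stmt-BirchSwinnertonDyer-24198),
# line `birth` v3, registered STUB B1 `stub_residualSelmerFinite`: REDUCTION TO THE RESIDUAL REPRESENTATION `E[3]`

STUB B1 of the line `birth` (skeleton v3 `f4498654b697668f`) asks, on the Leopoldt cell, for the finiteness of the
`3`-torsion `Sel_{𝔭′}(K_∞, E[3^∞])[3]` of Castella's anticyclotomic Selmer group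
(`{s : AcSelmer.selmerAc (E/K) 3 κ 𝔭′ ∅ | 3 • s = 0}`). Its printed model is Castella–Grossi–Lee–Skinner 2022, §3
(arXiv:2008.02571 §1), Prop. «propmodp»: `H¹_{F_Gr}(K, M_E[p]) ≅ H¹_{F_Gr}(K, M_E)[p]` is finite — the FIRST step of
which is the passage from `E[p^∞]`-coefficients to the residual representation `E[p]` through the Kummer sequence
`0 → E(K_∞)[p^∞]/p → H¹(K_∞, E[p]) → H¹(K_∞, E[p^∞])[p] → 0`. This file PROVES that first step on the tree's
constructed objects, for EVERY elliptic curve `E` over a number field `K`, prime `p`, `ℤ_p`-extension `κ`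
(`K_∞ = K̄^{ker κ}`), distinguished prime `𝔭` and imprimitivity set `Σ`:

* §1 `exists_lift_of_nsmul_eq_zero` / `nsmul_torsionToPrimaryH1Sub` — every `s ∈ Sel_𝔭^Σ(K_∞, E[p^∞])` with
  `p s = 0` is the image of a class `y ∈ H¹(K_∞, E[p])` (tree Kummer lift `exists_torsionToPrimaryH1Sub_eq`,
  Greenberg LNM 1716 §5), and every image is `p`-torsion;
  **`finite_pTorsion_iff_finite_lifts`**: `Sel_𝔭^Σ(K_∞, E[p^∞])[p]` is finite **iff** the set of RESIDUAL LIFTS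
  `{y ∈ H¹(K_∞, E[p]) | ι y ∈ Sel_𝔭^Σ}` is finite (`⇐` image of a finite set; `⇒` the kernel of
  `ι : H¹(K_∞, E[p]) → H¹(K_∞, E[p^∞])` is finite, tree `finite_ker_torsionToPrimaryH1Sub`).
* §2 `lifts_subset_residualSelmer` — every residual lift is UNRAMIFIED at every prime `𝔓` of `K̄` above a place
  `v ∉ Σ ∪ {bad} ∪ {v ∣ p}` (tree (B′) `resOfLe_eq_zero_of_mem_selmerOver`: Castella's local triviality + good
  reduction, AEC VIII.1.4) and satisfies Castella's STRICT condition above `𝔭` (read in `E[p^∞]`); hence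
  **`finite_pTorsion_of_finite_residualSelmer`**: B1's conclusion follows from the finiteness of the explicit
  residual Selmer set `R_𝔭^{Σ'}(K_∞, E[p]) = {y ∈ H¹(K_∞, E[p]) | y unramified outside Σ' , ι(conj_σ y) strict at 𝔭 ∀σ}`,
  `Σ' = Σ ∪ {bad} ∪ {v ∣ p}` — the tree's rendering of CGLS's `H¹_{F_Gr^S}(K, M_E[p])` (imprimitive at the bad
  places, relaxed above the other primes over `p`).
* §3 the registered stub (p = 3, signature VERBATIM as conclusion) from the cell-wide finiteness of the residual
  Selmer sets (`stub_residualSelmerFinite_of_forall_finite_residualSelmer`) and from the cell-wide finiteness of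
  the residual lifts (`stub_residualSelmerFinite_of_forall_finite_lifts`).

What is NOT done here (the remaining content of B1 = CGLS Prop. 17–18 with Thm. 11 (Rubin–Hida / Oukhaba–Viguié
μ = 0) for the characters φ, ψ of `E[3]^ss` on the non-anomalous cell): the dévissage of `R(K_∞, E[3])` along
`0 → 𝔽₃(φ) → E[3] → 𝔽₃(ψ) → 0` and the finiteness of the two character Selmer groups.

THEOREMS ONLY (`--supports stmt-BirchSwinnertonDyer-24198`); no definition, no named fact, no `sorry`. Seat
bsd-line-chl-k1-p1-w2 (width prover, stub B1). BSD is not proved by any of this.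

References: [CastellaGrossiLeeSkinner2022] §3.3 Prop. 3.3.2/«propmodp», Lemma «rmkchar» (arXiv:2008.02571 §1);
[GreenbergLNM1716] §1 p. 60, §5 p. 114; [Castella2018] Def. 2.2 (arXiv:1704.06608 p. 5); [SilvermanAEC2009] VIII.1.4, X.4.3.
-/

set_option autoImplicit false
set_option linter.dupNamespace false

noncomputable section

open scoped Classical

namespace Summit.BirchSwinnertonDyer.BirchSwinnertonDyer.Theorems.CumulativeHeegnerInclusionAtThreeStubB1

open Literature.NumberTheory.EllipticCurves Literature.NumberTheory.GaloisRepresentations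
  Literature.NumberTheory.EllipticCurves.GreenbergSelmer NumberField IsDedekindDomain Field WeierstrassCurve
  Summit.BirchSwinnertonDyer.Rank1Residual.X11b Summit.BirchSwinnertonDyer.Rank1Residual.X11b.AcSelmer

universe u

variable {K : Type u} [Field K] [NumberField K] (W : WeierstrassCurve K) (p : ℕ) [hp : Fact p.Prime]
  (κ : ZpExtension K p) (𝔭 : HeightOneSpectrum (𝓞 K)) (S : Set (HeightOneSpectrum (𝓞 K)))

/-! ### §1 `Sel_𝔭^Σ(K_∞, E[p^∞])[p]` versus the residual lifts in `H¹(K_∞, E[p])` -/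

section Lifts

omit [NumberField K] hp in
/-- **Classes of `H¹(H, E[p])` are `p`-torsion** (the coefficients are). [folklore] -/
theorem nsmul_subgroupH1_geomTorsion_eq_zero (H : Subgroup (absoluteGaloisGroup K))
    (y : Literature.NumberTheory.EllipticCurves.subgroupH1 H (W.geomTorsion (p : ℤ))) : p • y = 0 := by
  obtain ⟨φ, rfl⟩ := oneCocycleClass_surjective _ y
  have hpM : ∀ m : W.geomTorsion (p : ℤ), (p : ℤ) • m = 0 := fun m ↦
    Subtype.ext (by rw [AddSubgroupClass.coe_zsmul, ZeroMemClass.coe_zero]; exact m.2)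
  have hφ : ((p : ℤ) • φ) = 0 := by
    refine Subtype.ext (ContinuousMap.ext fun σ ↦ ?_)
    change (p : ℤ) • φ.1 σ = 0
    exact hpM _
  rw [← Nat.cast_smul_eq_nsmul ℤ, ← oneCocycleClass_smul, hφ, oneCocycleClass_zero]

omit [NumberField K] hp in
/-- **Images of residual classes are `p`-torsion**: `p · ι(y) = 0` for
`ι : H¹(K_∞, E[p]) → H¹(K_∞, E[p^∞])`. [folklore] -/
theorem nsmul_torsionToPrimaryH1Sub (H : Subgroup (absoluteGaloisGroup K))
    (y : Literature.NumberTheory.EllipticCurves.subgroupH1 H (W.geomTorsion (p : ℤ))) :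
    p • W.torsionToPrimaryH1Sub p H y = 0 := by
  rw [← map_nsmul, nsmul_subgroupH1_geomTorsion_eq_zero W p H y, map_zero]

/-- **Kummer lift of `p`-torsion Selmer classes**: every `s ∈ Sel_𝔭^Σ(K_∞, E[p^∞])` with `p s = 0` is
`ι(y)` for some `y ∈ H¹(K_∞, E[p])` (tree `exists_torsionToPrimaryH1Sub_eq`; `E(K̄)` is `p`-divisible,
`zsmul_geomPoints_surjective_holds`). [cite: GreenbergLNM1716, §5 p. 114] -/
theorem exists_lift_of_nsmul_eq_zero [W.IsElliptic] {s : selmerAc W p κ 𝔭 S} (hs : p • s = 0) :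
    ∃ y : Literature.NumberTheory.EllipticCurves.subgroupH1 κ.kerSubgroup (W.geomTorsion (p : ℤ)),
      W.torsionToPrimaryH1Sub p κ.kerSubgroup y = (s : W.subgroupH1 p κ.kerSubgroup) := by
  have hps : p • (s : W.subgroupH1 p κ.kerSubgroup) = 0 := by
    rw [← AddSubgroupClass.coe_nsmul, hs, ZeroMemClass.coe_zero]
  exact W.exists_torsionToPrimaryH1Sub_eq p (H := κ.kerSubgroup) W.zsmul_geomPoints_surjective_holds hps

/-- **`Sel_𝔭^Σ(K_∞, E[p^∞])[p]` is finite if the residual lifts are**: it is the image of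
`{y ∈ H¹(K_∞, E[p]) | ι y ∈ Sel_𝔭^Σ}` under `ι`. [cite: GreenbergLNM1716, §5 p. 114] -/
theorem finite_pTorsion_of_finite_lifts [W.IsElliptic]
    (hfin : Set.Finite {y : Literature.NumberTheory.EllipticCurves.subgroupH1 κ.kerSubgroup
        (W.geomTorsion (p : ℤ)) | W.torsionToPrimaryH1Sub p κ.kerSubgroup y ∈ selmerAc W p κ 𝔭 S}) :
    Set.Finite {s : selmerAc W p κ 𝔭 S | p • s = 0} := by
  refine ((hfin.image (W.torsionToPrimaryH1Sub p κ.kerSubgroup)).preimage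
    Subtype.val_injective.injOn).subset ?_
  intro s hs
  obtain ⟨y, hy⟩ := exists_lift_of_nsmul_eq_zero W p κ 𝔭 S hs
  refine ⟨y, ?_, hy⟩
  show W.torsionToPrimaryH1Sub p κ.kerSubgroup y ∈ selmerAc W p κ 𝔭 S
  rw [hy]
  exact s.2

/-- **Conversely the residual lifts are finite if `Sel_𝔭^Σ(K_∞, E[p^∞])[p]` is**: `ι` maps the lifts into
`Sel[p]` (`nsmul_torsionToPrimaryH1Sub`) with finite fibres, the kernel of `ι` being finite (tree
`finite_ker_torsionToPrimaryH1Sub`: it is `E(K_∞)[p^∞]/p`). [cite: GreenbergLNM1716, §3 (proof of Lemma 3.1)] -/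
theorem finite_lifts_of_finite_pTorsion [W.IsElliptic]
    (hfin : Set.Finite {s : selmerAc W p κ 𝔭 S | p • s = 0}) :
    Set.Finite {y : Literature.NumberTheory.EllipticCurves.subgroupH1 κ.kerSubgroup
        (W.geomTorsion (p : ℤ)) | W.torsionToPrimaryH1Sub p κ.kerSubgroup y ∈ selmerAc W p κ 𝔭 S} := by
  let ιN := W.torsionToPrimaryH1Sub p κ.kerSubgroup
  have hF₀ := W.finite_ker_torsionToPrimaryH1Sub p (H := κ.kerSubgroup) W.zsmul_geomPoints_surjective_holds
  -- the finite set of targets, seen in `H¹(K_∞, E[p^∞])`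
  let T : Set (W.subgroupH1 p κ.kerSubgroup) :=
    (Subtype.val : selmerAc W p κ 𝔭 S → W.subgroupH1 p κ.kerSubgroup) '' {s | p • s = 0}
  have hT : T.Finite := hfin.image _
  -- lifts ⊆ ⋃_{t ∈ T} ι⁻¹{t}, each fibre a translate of the finite kernel (or empty)
  have hsub : {y : Literature.NumberTheory.EllipticCurves.subgroupH1 κ.kerSubgroup (W.geomTorsion (p : ℤ)) |
      ιN y ∈ selmerAc W p κ 𝔭 S} ⊆ ⋃ t ∈ T, {y | ιN y = t} := by
    intro y hy
    simp only [Set.mem_iUnion, Set.mem_setOf_eq, exists_prop]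
    refine ⟨ιN y, ⟨⟨ιN y, hy⟩, ?_, rfl⟩, rfl⟩
    show p • (⟨ιN y, hy⟩ : selmerAc W p κ 𝔭 S) = 0
    exact Subtype.ext (by
      rw [AddSubgroupClass.coe_nsmul, ZeroMemClass.coe_zero]; exact nsmul_torsionToPrimaryH1Sub W p _ y)
  refine (hT.biUnion fun t _ ↦ ?_).subset hsub
  by_cases hne : {y : Literature.NumberTheory.EllipticCurves.subgroupH1 κ.kerSubgroup (W.geomTorsion (p : ℤ)) |
      ιN y = t}.Nonempty
  · obtain ⟨y₀, hy₀⟩ := hne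
    refine (hF₀.image fun f ↦ y₀ + f).subset ?_
    intro y hy
    refine ⟨y - y₀, ?_, by abel⟩
    rw [SetLike.mem_coe, AddMonoidHom.mem_ker, map_sub]
    rw [Set.mem_setOf_eq] at hy hy₀
    rw [hy, hy₀, sub_self]
  · rw [Set.not_nonempty_iff_eq_empty.mp hne]
    exact Set.finite_empty

/-- **`Sel_𝔭^Σ(K_∞, E[p^∞])[p]` is finite iff the residual lifts `{y ∈ H¹(K_∞, E[p]) | ι y ∈ Sel_𝔭^Σ}` are**
(the Kummer sequence `0 → E(K_∞)[p^∞]/p → H¹(K_∞, E[p]) → H¹(K_∞, E[p^∞])[p] → 0` with finite first term;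
CGLS Lemma «rmkchar»-shape on the tree's object, WITHOUT the hypothesis `E(K_∞)[p] = 0`).
[cite: CastellaGrossiLeeSkinner2022, Lemma 3.1.? «rmkchar» and Prop. «propmodp» (arXiv:2008.02571 §1)] [cite: GreenbergLNM1716, §5 p. 114] -/
theorem finite_pTorsion_iff_finite_lifts [W.IsElliptic] :
    Set.Finite {s : selmerAc W p κ 𝔭 S | p • s = 0} ↔
      Set.Finite {y : Literature.NumberTheory.EllipticCurves.subgroupH1 κ.kerSubgroup
        (W.geomTorsion (p : ℤ)) | W.torsionToPrimaryH1Sub p κ.kerSubgroup y ∈ selmerAc W p κ 𝔭 S} :=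
  ⟨finite_lifts_of_finite_pTorsion W p κ 𝔭 S, finite_pTorsion_of_finite_lifts W p κ 𝔭 S⟩

end Lifts

/-! ### §2 The residual lifts lie in the residual Selmer set `R_𝔭^{Σ'}(K_∞, E[p])` -/

section Residual

/-- **Residual lifts are unramified outside `Σ' = Σ ∪ {bad} ∪ {v ∣ p}` and strict at `𝔭`.** If `ι y` lies in
`Sel_𝔭^Σ(K_∞, E[p^∞])` then (i) `y` restricts to `0` on every inertia group `I_𝔓 ≤ Gal(K̄/K_∞)` above a place
`v ∉ Σ`, `v ∤ p`, of good reduction (tree (B′) `resOfLe_eq_zero_of_mem_selmerOver`; `I_𝔓 ≤ ker κ` automatically,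
`ZpExtension.inertia_le_kerSubgroup_holds`), and (ii) every conjugate `conj_σ (ι y)` satisfies Castella's strict
condition above `𝔭`. [cite: SilvermanAEC2009, VIII.1.4 and X.4.3] [cite: Castella2018, Def. 2.2 (arXiv:1704.06608 p. 5)] -/
theorem lifts_subset_residualSelmer [W.IsElliptic] :
    {y : Literature.NumberTheory.EllipticCurves.subgroupH1 κ.kerSubgroup (W.geomTorsion (p : ℤ)) |
        W.torsionToPrimaryH1Sub p κ.kerSubgroup y ∈ selmerAc W p κ 𝔭 S} ⊆
      {y | (∀ v : HeightOneSpectrum (𝓞 K), v ∉ W.badPlaces (𝓞 K) → (p : 𝓞 K) ∉ v.asIdeal → v ∉ S →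
            ∀ 𝔓 ∈ v.primesAbove, ∀ hle : 𝔓.inertia (absoluteGaloisGroup K) ≤ κ.kerSubgroup,
              Literature.NumberTheory.EllipticCurves.resOfLe (W.geomTorsion (p : ℤ)) hle y = 0) ∧
          ∀ σ : absoluteGaloisGroup K,
            W.conjH1 p κ.kerSubgroup σ (W.torsionToPrimaryH1Sub p κ.kerSubgroup y) ∈
              (strictDatum (W.geomPrimaryTorsion p) 𝔭).strictKer κ.kerSubgroup} := by
  intro y hy
  have hy' : W.torsionToPrimaryH1Sub p κ.kerSubgroup y ∈
      selmerOver κ.kerSubgroup (W.geomPrimaryTorsion p) p 𝔭 S := hy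
  have hstr := ((mem_selmerOver_iff _).mp hy').2.2
  refine ⟨fun v hv hpv hvS 𝔓 h𝔓 hle ↦ ?_, fun σ ↦ hstr σ⟩
  exact resOfLe_eq_zero_of_mem_selmerOver (H := κ.kerSubgroup) hy' hv hpv hvS h𝔓 hle

/-- **B1's conclusion from the finiteness of the residual Selmer set.** If
`R_𝔭^{Σ'}(K_∞, E[p]) = {y ∈ H¹(K_∞, E[p]) | y unramified above every good v ∉ Σ, v ∤ p; conj_σ(ι y) strict at 𝔭 ∀ σ}`
is finite, then `Sel_𝔭^Σ(K_∞, E[p^∞])[p]` is finite (every elliptic `E/K`, every `p`, `κ`, `𝔭`, `Σ`). This is the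
tree's form of «`H¹_{F_Gr^S}(K, M_E[p])` finite ⟹ `H¹_{F_Gr^S}(K, M_E)[p]` finite» (CGLS Prop. «propmodp», first half).
[cite: CastellaGrossiLeeSkinner2022, Prop. «propmodp» (arXiv:2008.02571 §1.4)] [cite: GreenbergLNM1716, §5 p. 114] -/
theorem finite_pTorsion_of_finite_residualSelmer [W.IsElliptic]
    (hfin : Set.Finite {y : Literature.NumberTheory.EllipticCurves.subgroupH1 κ.kerSubgroup
        (W.geomTorsion (p : ℤ)) |
        (∀ v : HeightOneSpectrum (𝓞 K), v ∉ W.badPlaces (𝓞 K) → (p : 𝓞 K) ∉ v.asIdeal → v ∉ S →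
            ∀ 𝔓 ∈ v.primesAbove, ∀ hle : 𝔓.inertia (absoluteGaloisGroup K) ≤ κ.kerSubgroup,
              Literature.NumberTheory.EllipticCurves.resOfLe (W.geomTorsion (p : ℤ)) hle y = 0) ∧
          ∀ σ : absoluteGaloisGroup K,
            W.conjH1 p κ.kerSubgroup σ (W.torsionToPrimaryH1Sub p κ.kerSubgroup y) ∈
              (strictDatum (W.geomPrimaryTorsion p) 𝔭).strictKer κ.kerSubgroup}) :
    Set.Finite {s : selmerAc W p κ 𝔭 S | p • s = 0} :=
  finite_pTorsion_of_finite_lifts W p κ 𝔭 S (hfin.subset (lifts_subset_residualSelmer W p κ 𝔭 S))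

end Residual

/-! ### §3 The registered stub B1 (p = 3) from cell-wide residual finiteness -/

section StubB1

/-- **STUB B1 ⇐ finiteness of the residual lifts on the cell.** If for every `W/ℚ`, Heegner field `K`,
anticyclotomic `κ` and `𝔭′ ∣ 3` on the Leopoldt cell the residual lifts
`{y ∈ H¹(K_∞, E[3]) | ι y ∈ Sel_{𝔭′}(K_∞, E[3^∞])}` are finite, then the registered stub
`stub_residualSelmerFinite` of `Cruxes/CumulativeHeegnerInclusionAtThree/Lines/birth.lean` (v3) holds
(signature verbatim as the conclusion). [cite: GreenbergLNM1716, §5 p. 114] [cite: CastellaGrossiLeeSkinner2022, Prop. «propmodp» (arXiv:2008.02571 §1.4)] -/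
theorem stub_residualSelmerFinite_of_forall_finite_lifts
    (h : ∀ (W : WeierstrassCurve ℚ) [W.IsElliptic] [W.IsGloballyMinimal] (N : ℕ) [NeZero N] (K : Type) [Field K]
      [NumberField K], Summit.BirchSwinnertonDyer.Rank1Residual.Additive.ClassO6 W 3 →
      Literature.NumberTheory.EllipticCurves.Rank1Residual.Red W 3 →
      (∃ Φ : AddSubgroup (WeierstrassCurve.geomTorsion W ((3 : ℕ) : ℤ)),
        Literature.NumberTheory.EllipticCurves.Rank1Residual.IsRationalLine W 3 Φ ∧
        ∀ (v : IsDedekindDomain.HeightOneSpectrum (NumberField.RingOfIntegers ℚ)),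
          ((3 : ℕ) : NumberField.RingOfIntegers ℚ) ∈ v.asIdeal → ∀ 𝔓 ∈ v.primesAbove,
          ¬ (∀ g ∈ 𝔓.decompositionSubgroup (Field.absoluteGaloisGroup ℚ), ∀ P ∈ Φ, g • P = P) ∧
          ¬ (∀ g ∈ 𝔓.decompositionSubgroup (Field.absoluteGaloisGroup ℚ),
            ∀ P : WeierstrassCurve.geomTorsion W ((3 : ℕ) : ℤ), g • P - P ∈ Φ)) →
      W.conductorNorm ℤ = N → Literature.NumberTheory.EllipticCurves.IsImaginaryQuadratic K →
      Literature.NumberTheory.EllipticCurves.SatisfiesHeegnerHypothesis N K →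
      ∀ (κ : Literature.NumberTheory.EllipticCurves.ZpExtension K 3), κ.IsAnticyclotomic →
      ∀ (𝔭' : IsDedekindDomain.HeightOneSpectrum (NumberField.RingOfIntegers K)),
        ((3 : ℕ) : NumberField.RingOfIntegers K) ∈ 𝔭'.asIdeal →
      Set.Finite {y : Literature.NumberTheory.EllipticCurves.subgroupH1 κ.kerSubgroup
          ((W.baseChange K).geomTorsion ((3 : ℕ) : ℤ)) |
        (W.baseChange K).torsionToPrimaryH1Sub 3 κ.kerSubgroup y ∈
          Summit.BirchSwinnertonDyer.Rank1Residual.X11b.AcSelmer.selmerAc (W.baseChange K) 3 κ 𝔭' ∅}) :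
    ∀ (W : WeierstrassCurve ℚ) [W.IsElliptic] [W.IsGloballyMinimal] (N : ℕ) [NeZero N] (K : Type) [Field K] [NumberField K], Summit.BirchSwinnertonDyer.Rank1Residual.Additive.ClassO6 W 3 → Literature.NumberTheory.EllipticCurves.Rank1Residual.Red W 3 → (∃ Φ : AddSubgroup (WeierstrassCurve.geomTorsion W ((3 : ℕ) : ℤ)), Literature.NumberTheory.EllipticCurves.Rank1Residual.IsRationalLine W 3 Φ ∧ ∀ (v : IsDedekindDomain.HeightOneSpectrum (NumberField.RingOfIntegers ℚ)), ((3 : ℕ) : NumberField.RingOfIntegers ℚ) ∈ v.asIdeal → ∀ 𝔓 ∈ v.primesAbove, ¬ (∀ g ∈ 𝔓.decompositionSubgroup (Field.absoluteGaloisGroup ℚ), ∀ P ∈ Φ, g • P = P) ∧ ¬ (∀ g ∈ 𝔓.decompositionSubgroup (Field.absoluteGaloisGroup ℚ), ∀ P : WeierstrassCurve.geomTorsion W ((3 : ℕ) : ℤ), g • P - P ∈ Φ)) → W.conductorNorm ℤ = N → Literature.NumberTheory.EllipticCurves.IsImaginaryQuadratic K → Literature.NumberTheory.EllipticCurves.SatisfiesHeegnerHypothesis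 N K → ∀ (κ : Literature.NumberTheory.EllipticCurves.ZpExtension K 3), κ.IsAnticyclotomic → ∀ (𝔭' : IsDedekindDomain.HeightOneSpectrum (NumberField.RingOfIntegers K)), ((3 : ℕ) : NumberField.RingOfIntegers K) ∈ 𝔭'.asIdeal → Set.Finite {s : Summit.BirchSwinnertonDyer.Rank1Residual.X11b.AcSelmer.selmerAc (W.baseChange K) 3 κ 𝔭' ∅ | (3 : ℕ) • s = 0} := by
  intro W _ _ N _ K _ _ hO6 hRed hcell hN hK hHg κ hκ 𝔭' h𝔭'
  haveI : (W.baseChange K).IsElliptic := inferInstanceAs (W.map (algebraMap ℚ K)).IsElliptic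
  exact finite_pTorsion_of_finite_lifts (W.baseChange K) 3 κ 𝔭' ∅
    (h W N K hO6 hRed hcell hN hK hHg κ hκ 𝔭' h𝔭')

/-- **STUB B1 ⇐ finiteness of the residual Selmer sets `R_{𝔭′}^{Σ'}(K_∞, E[3])` on the cell** (`Σ' = {bad} ∪ {v ∣ 3}`):
if at every algebraic frame of the Leopoldt cell the classes of `H¹(K_∞, E[3])` unramified above every good
`v ∤ 3` and whose images are strict at `𝔭′` form a finite set, then `stub_residualSelmerFinite` holds (signature
verbatim as the conclusion). The hypothesis is the tree's rendering of CGLS's «`H¹_{F_Gr^S}(K, M_E[p])` finite»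
(their Prop. 17, from φ, ψ and Thm. 11) on the cell.
[cite: CastellaGrossiLeeSkinner2022, Prop. 17–18 (arXiv:2008.02571 §1.4)] [cite: GreenbergLNM1716, §5 p. 114] -/
theorem stub_residualSelmerFinite_of_forall_finite_residualSelmer
    (h : ∀ (W : WeierstrassCurve ℚ) [W.IsElliptic] [W.IsGloballyMinimal] (N : ℕ) [NeZero N] (K : Type) [Field K]
      [NumberField K], Summit.BirchSwinnertonDyer.Rank1Residual.Additive.ClassO6 W 3 →
      Literature.NumberTheory.EllipticCurves.Rank1Residual.Red W 3 →
      (∃ Φ : AddSubgroup (WeierstrassCurve.geomTorsion W ((3 : ℕ) : ℤ)),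
        Literature.NumberTheory.EllipticCurves.Rank1Residual.IsRationalLine W 3 Φ ∧
        ∀ (v : IsDedekindDomain.HeightOneSpectrum (NumberField.RingOfIntegers ℚ)),
          ((3 : ℕ) : NumberField.RingOfIntegers ℚ) ∈ v.asIdeal → ∀ 𝔓 ∈ v.primesAbove,
          ¬ (∀ g ∈ 𝔓.decompositionSubgroup (Field.absoluteGaloisGroup ℚ), ∀ P ∈ Φ, g • P = P) ∧
          ¬ (∀ g ∈ 𝔓.decompositionSubgroup (Field.absoluteGaloisGroup ℚ),
            ∀ P : WeierstrassCurve.geomTorsion W ((3 : ℕ) : ℤ), g • P - P ∈ Φ)) →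
      W.conductorNorm ℤ = N → Literature.NumberTheory.EllipticCurves.IsImaginaryQuadratic K →
      Literature.NumberTheory.EllipticCurves.SatisfiesHeegnerHypothesis N K →
      ∀ (κ : Literature.NumberTheory.EllipticCurves.ZpExtension K 3), κ.IsAnticyclotomic →
      ∀ (𝔭' : IsDedekindDomain.HeightOneSpectrum (NumberField.RingOfIntegers K)),
        ((3 : ℕ) : NumberField.RingOfIntegers K) ∈ 𝔭'.asIdeal →
      Set.Finite {y : Literature.NumberTheory.EllipticCurves.subgroupH1 κ.kerSubgroup
          ((W.baseChange K).geomTorsion ((3 : ℕ) : ℤ)) |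
        (∀ v : IsDedekindDomain.HeightOneSpectrum (NumberField.RingOfIntegers K),
            v ∉ (W.baseChange K).badPlaces (NumberField.RingOfIntegers K) →
            ((3 : ℕ) : NumberField.RingOfIntegers K) ∉ v.asIdeal →
            ∀ 𝔓 ∈ v.primesAbove, ∀ hle : 𝔓.inertia (Field.absoluteGaloisGroup K) ≤ κ.kerSubgroup,
              Literature.NumberTheory.EllipticCurves.resOfLe ((W.baseChange K).geomTorsion ((3 : ℕ) : ℤ)) hle y = 0) ∧
          ∀ σ : Field.absoluteGaloisGroup K,
            (W.baseChange K).conjH1 3 κ.kerSubgroup σ ((W.baseChange K).torsionToPrimaryH1Sub 3 κ.kerSubgroup y) ∈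
              (Summit.BirchSwinnertonDyer.Rank1Residual.X11b.AcSelmer.strictDatum
                ((W.baseChange K).geomPrimaryTorsion 3) 𝔭').strictKer κ.kerSubgroup}) :
    ∀ (W : WeierstrassCurve ℚ) [W.IsElliptic] [W.IsGloballyMinimal] (N : ℕ) [NeZero N] (K : Type) [Field K] [NumberField K], Summit.BirchSwinnertonDyer.Rank1Residual.Additive.ClassO6 W 3 → Literature.NumberTheory.EllipticCurves.Rank1Residual.Red W 3 → (∃ Φ : AddSubgroup (WeierstrassCurve.geomTorsion W ((3 : ℕ) : ℤ)), Literature.NumberTheory.EllipticCurves.Rank1Residual.IsRationalLine W 3 Φ ∧ ∀ (v : IsDedekindDomain.HeightOneSpectrum (NumberField.RingOfIntegers ℚ)), ((3 : ℕ) : NumberField.RingOfIntegers ℚ) ∈ v.asIdeal → ∀ 𝔓 ∈ v.primesAbove, ¬ (∀ g ∈ 𝔓.decompositionSubgroup (Field.absoluteGaloisGroup ℚ), ∀ P ∈ Φ, g • P = P) ∧ ¬ (∀ g ∈ 𝔓.decompositionSubgroup (Field.absoluteGaloisGroup ℚ), ∀ P : WeierstrassCurve.geomTorsion W ((3 : ℕ)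 : ℤ), g • P - P ∈ Φ)) → W.conductorNorm ℤ = N → Literature.NumberTheory.EllipticCurves.IsImaginaryQuadratic K → Literature.NumberTheory.EllipticCurves.SatisfiesHeegnerHypothesis N K → ∀ (κ : Literature.NumberTheory.EllipticCurves.ZpExtension K 3), κ.IsAnticyclotomic → ∀ (𝔭' : IsDedekindDomain.HeightOneSpectrum (NumberField.RingOfIntegers K)), ((3 : ℕ) : NumberField.RingOfIntegers K) ∈ 𝔭'.asIdeal → Set.Finite {s : Summit.BirchSwinnertonDyer.Rank1Residual.X11b.AcSelmer.selmerAc (W.baseChange K) 3 κ 𝔭' ∅ | (3 : ℕ) • s = 0} := by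
  intro W _ _ N _ K _ _ hO6 hRed hcell hN hK hHg κ hκ 𝔭' h𝔭'
  haveI : (W.baseChange K).IsElliptic := inferInstanceAs (W.map (algebraMap ℚ K)).IsElliptic
  refine finite_pTorsion_of_finite_residualSelmer (W.baseChange K) 3 κ 𝔭' ∅ ((h W N K hO6 hRed hcell hN hK hHg κ hκ 𝔭' h𝔭').subset ?_)
  rintro y ⟨hunr, hstr⟩
  exact ⟨fun v hv hpv 𝔓 h𝔓 hle ↦ hunr v hv hpv (Set.notMem_empty v) 𝔓 h𝔓 hle, hstr⟩

end StubB1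

end Summit.BirchSwinnertonDyer.BirchSwinnertonDyer.Theorems.CumulativeHeegnerInclusionAtThreeStubB1

end
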